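import Mathlib
import Literature.Analysis.FluidPDE.Tao2016AveragedNS.ShiftSetCascadeFlows
import Literature.Analysis.FluidPDE.Tao2016AveragedNS.RestartedCascadeFlows
import Summits.NavierStokesRegularity.NavierStokesRegularity.Theorems.TaoLadderRungThreeGappedFrontRobustGaussianWeights
import HarnessLib

/-!
# Certificate glue on a shift set `𝕊`, VI: the PIECEWISE-GAUSSIAN WEIGHT of the flat line's registered stubs —
  its statics and the admissibility constants of the existence weight (helper for item
  stmt-NavierStokesRegularity-22987 `FlatGapCertificatesV2`, crux K_A♭ of route TaoLadderRungTwoFlat; cell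
  harvest/h2-tao-ladder, p1 g13)

The registered stubs `stub_rung` / `stub_rung_quarter` of K_A♭ exhibit weights `w_k = C_w·2^{k²/2 + b k}` for
`k ≥ 0` (`C_w ≥ 1`, `b ≥ 1/2`); behind the front we take them flat, `w_k = C_w` for `k < 0`. This file proves,
for ANY `w` of that piecewise shape and `0 ≤ ε₀ ≤ 1`, the weight statics consumed by the glue theorems
(`gapData₂On_of_windowCertificate`, `noGlobalCascadeOn_of_windowCertificate`): `w ≥ 1`; tameness behind
(`w_k ≤ C_w (1+ε₀)^{-k}`, `k ≤ 0`); monotonicity `w_k ≤ w_{k+1}`; (T1) `2(1+ε₀)^k w_k ≤ w_{k+1}` for `k ≥ 0`;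
`TailThin ε₀ w r`; and, for the SHIFTED weight `ω_k = w_{k-1}` used as the Banach-space weight of the existence
theory, the three ratio bounds of `weightRatiosLEOn_of_nearestNeighbour` with the explicit constants
`A₁ = 32`, `A₂ = 1`, `A₃ = 2^{(9/2-b)²/2 + 2b}`, the a priori class bound `(1+(1+ε₀)^{10k})/ω_k ≤ 2^{57}`, and
the domination `ω_k ≤ w_{Ka-1}` (`k ≤ Ka`), `ω_k ≤ w_{Ka-1} · w_{k-1}` (`k > Ka`). Elementary real-number
inequalities (the exponent comparisons are completed squares).

HONEST FRAMING: inequalities about a weight family; nothing is asserted about any table or flow, and nothing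
here is a statement about the Navier–Stokes equations.
-/

noncomputable section

-- the sub-problem namespace repeats the summit name by design (D-0017)
set_option linter.dupNamespace false

namespace Summit.NavierStokesRegularity.NavierStokesRegularity.Theorems

open Set Literature.Analysis.FluidPDE Literature.Analysis.FluidPDE.TaoCascade

namespace CertificateGlueOn

section PiecewiseGaussian

variable {w : ℤ → ℝ} {Cw b : ℝ}

/-- The Gaussian exponent `k²/2 + b k` is nonnegative for `k ≥ 0`, `b ≥ 0`. [folklore] -/
theorem gaussExp_nonneg {b : ℝ} (hb : 0 ≤ b) {k : ℤ} (hk : 0 ≤ k) : 0 ≤ (k : ℝ) ^ 2 / 2 + b * k := by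
  have : (0 : ℝ) ≤ k := by exact_mod_cast hk
  positivity

/-- **The piecewise-Gaussian weight is `≥ C_w ≥ 1`.** [folklore] -/
theorem pgw_ge (hCw : 1 ≤ Cw) (hb : 1 / 2 ≤ b)
    (hwp : ∀ k : ℤ, 0 ≤ k → w k = Cw * (2 : ℝ) ^ ((k : ℝ) ^ 2 / 2 + b * k))
    (hwn : ∀ k : ℤ, k < 0 → w k = Cw) (k : ℤ) : Cw ≤ w k := by
  by_cases hk : 0 ≤ k
  · rw [hwp k hk]
    have h1 : (1 : ℝ) ≤ (2 : ℝ) ^ ((k : ℝ) ^ 2 / 2 + b * k) :=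
      Real.one_le_rpow one_le_two (gaussExp_nonneg (by linarith) hk)
    nlinarith
  · rw [hwn k (by omega)]

/-- **The piecewise-Gaussian weight is `≥ 1`.** [folklore] -/
theorem pgw_one_le (hCw : 1 ≤ Cw) (hb : 1 / 2 ≤ b)
    (hwp : ∀ k : ℤ, 0 ≤ k → w k = Cw * (2 : ℝ) ^ ((k : ℝ) ^ 2 / 2 + b * k))
    (hwn : ∀ k : ℤ, k < 0 → w k = Cw) (k : ℤ) : 1 ≤ w k :=
  hCw.trans (pgw_ge hCw hb hwp hwn k)

/-- **Tameness behind**: `w_k ≤ C_w (1+ε₀)^{-k}` for `k ≤ 0` (`ε₀ ≥ 0`). [folklore] -/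
theorem pgw_tame {ε₀ : ℝ} (hε : 0 ≤ ε₀)
    (hwp : ∀ k : ℤ, 0 ≤ k → w k = Cw * (2 : ℝ) ^ ((k : ℝ) ^ 2 / 2 + b * k))
    (hwn : ∀ k : ℤ, k < 0 → w k = Cw) (hCw : 1 ≤ Cw) (k : ℤ) (hk : k ≤ 0) :
    w k ≤ Cw * (1 + ε₀) ^ (-(k : ℝ)) := by
  have h1 : (1 : ℝ) ≤ (1 + ε₀) ^ (-(k : ℝ)) :=
    Real.one_le_rpow (by linarith) (by have : (k : ℝ) ≤ 0 := (by exact_mod_cast hk); linarith)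
  have hwk : w k = Cw := by
    rcases eq_or_lt_of_le hk with h0 | hlt
    · rw [h0, hwp 0 le_rfl]; simp
    · exact hwn k hlt
  rw [hwk]
  nlinarith

/-- **Monotonicity**: `w_k ≤ w_{k+1}` for every `k` (`C_w ≥ 1`, `b ≥ 1/2`). [folklore] -/
theorem pgw_mono (hCw : 1 ≤ Cw) (hb : 1 / 2 ≤ b)
    (hwp : ∀ k : ℤ, 0 ≤ k → w k = Cw * (2 : ℝ) ^ ((k : ℝ) ^ 2 / 2 + b * k))
    (hwn : ∀ k : ℤ, k < 0 → w k = Cw) (k : ℤ) : w k ≤ w (k + 1) := by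
  by_cases hk : 0 ≤ k
  · rw [hwp k hk, hwp (k + 1) (by omega)]
    push_cast
    have hexp : (k : ℝ) ^ 2 / 2 + b * k ≤ ((k : ℝ) + 1) ^ 2 / 2 + b * ((k : ℝ) + 1) := by
      have : (0 : ℝ) ≤ k := by exact_mod_cast hk
      nlinarith
    exact mul_le_mul_of_nonneg_left (Real.rpow_le_rpow_of_exponent_le one_le_two hexp) (by linarith)
  · rw [hwn k (by omega)]
    exact pgw_ge hCw hb hwp hwn (k + 1)

/-- **(T1) ahead of the front**: `2 (1+ε₀)^k w_k ≤ w_{k+1}` for `k ≥ 0` (`0 ≤ ε₀ ≤ 1`, `C_w ≥ 1`, `b ≥ 1/2`).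
[folklore] -/
theorem pgw_T1 {ε₀ : ℝ} (hε : 0 ≤ ε₀) (hε1 : ε₀ ≤ 1) (hCw : 1 ≤ Cw) (hb : 1 / 2 ≤ b)
    (hwp : ∀ k : ℤ, 0 ≤ k → w k = Cw * (2 : ℝ) ^ ((k : ℝ) ^ 2 / 2 + b * k)) (k : ℤ) (hk : 0 ≤ k) :
    2 * (1 + ε₀) ^ (k : ℝ) * w k ≤ w (k + 1) := by
  have h := GappedFrontRobust.gaussian_weight_T1 hε hε1 (by linarith) hb
    (fun j : ℤ => Cw * (2 : ℝ) ^ ((j : ℝ) ^ 2 / 2 + b * j)) (fun j => rfl) k hk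
  rw [hwp k hk, hwp (k + 1) (by omega)]
  exact h

/-- **Thin tail**: `TailThin ε₀ w r` (`0 ≤ ε₀ ≤ 1`, `r ≥ 0`, `C_w ≥ 1`). [folklore] -/
theorem pgw_tailThin {ε₀ r : ℝ} (hε : 0 ≤ ε₀) (hε1 : ε₀ ≤ 1) (hr : 0 ≤ r) (hCw : 1 ≤ Cw)
    (hwp : ∀ k : ℤ, 0 ≤ k → w k = Cw * (2 : ℝ) ^ ((k : ℝ) ^ 2 / 2 + b * k)) : TailThin ε₀ w r := by
  intro ϑ hϑ
  obtain ⟨k₂, hk₂⟩ := GappedFrontRobust.gaussian_weight_tailThin hε hε1 hr (by linarith : 0 < Cw)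
    (fun j : ℤ => Cw * (2 : ℝ) ^ ((j : ℝ) ^ 2 / 2 + b * j)) (fun j => rfl) ϑ hϑ
  refine ⟨max k₂ 0, fun k hk => ?_⟩
  have hk0 : 0 ≤ k := le_trans (le_max_right _ _) hk
  have h := hk₂ k (le_trans (le_max_left _ _) hk)
  rw [hwp k hk0, hwp (k + 1) (by omega)]
  exact h

/-! ### The shifted weight `ω_k = w_{k-1}` as the Banach-space weight -/

/-- A lower bound for the Gaussian factor with `C_w ≥ 1`, `b ≥ 1/2`: `w_j ≥ 2^{j²/2 + j/2}` for `j ≥ 0`.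
[folklore] -/
theorem pgw_lower (hCw : 1 ≤ Cw) (hb : 1 / 2 ≤ b)
    (hwp : ∀ k : ℤ, 0 ≤ k → w k = Cw * (2 : ℝ) ^ ((k : ℝ) ^ 2 / 2 + b * k)) (j : ℤ) (hj : 0 ≤ j) :
    (2 : ℝ) ^ ((j : ℝ) ^ 2 / 2 + (j : ℝ) / 2) ≤ w j := by
  rw [hwp j hj]
  have hj0 : (0 : ℝ) ≤ j := by exact_mod_cast hj
  have h1 : (2 : ℝ) ^ ((j : ℝ) ^ 2 / 2 + (j : ℝ) / 2) ≤ (2 : ℝ) ^ ((j : ℝ) ^ 2 / 2 + b * j) :=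
    Real.rpow_le_rpow_of_exponent_le one_le_two (by nlinarith)
  have h2 : 0 ≤ (2 : ℝ) ^ ((j : ℝ) ^ 2 / 2 + b * j) := Real.rpow_nonneg zero_le_two _
  nlinarith

/-- **Same-shell ratio of the shifted weight**: `(1+ε₀)^{5k/2}/ω_k ≤ 32` (`0 ≤ ε₀ ≤ 1`; `5k/2 ≤ 5 + (k-1)²/2 +
(k-1)/2` is `(k-3)² + 1 ≥ 0`). [folklore] -/
theorem pgw_shift_ratio_same {ε₀ : ℝ} (hε : 0 ≤ ε₀) (hε1 : ε₀ ≤ 1) (hCw : 1 ≤ Cw) (hb : 1 / 2 ≤ b)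
    (hwp : ∀ k : ℤ, 0 ≤ k → w k = Cw * (2 : ℝ) ^ ((k : ℝ) ^ 2 / 2 + b * k))
    (hwn : ∀ k : ℤ, k < 0 → w k = Cw) {ω : ℤ → ℝ} (hω : ∀ k, ω k = w (k - 1)) (k : ℤ) :
    (1 + ε₀) ^ ((5 : ℝ) * k / 2) / ω k ≤ 32 := by
  have hωk : 1 ≤ ω k := by rw [hω]; exact pgw_one_le hCw hb hwp hwn _
  have hωpos : 0 < ω k := by linarith
  rw [div_le_iff₀ hωpos]
  by_cases hk : k ≤ 0
  · have h1 : (1 + ε₀) ^ ((5 : ℝ) * k / 2) ≤ 1 :=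
      Real.rpow_le_one_of_one_le_of_nonpos (by linarith)
        (by have : (k : ℝ) ≤ 0 := (by exact_mod_cast hk); linarith)
    nlinarith
  · push Not at hk
    have hk1 : 0 ≤ k - 1 := by omega
    have hlow := pgw_lower hCw hb hwp (k - 1) hk1
    rw [← hω] at hlow
    -- (1+ε₀)^{5k/2} ≤ 2^{5k/2} ≤ 32 · 2^{(k-1)²/2 + (k-1)/2}
    have hk0 : (0 : ℝ) ≤ k := by exact_mod_cast hk.le
    have h1 : (1 + ε₀) ^ ((5 : ℝ) * k / 2) ≤ (2 : ℝ) ^ ((5 : ℝ) * k / 2) :=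
      Real.rpow_le_rpow (by linarith) (by linarith) (by positivity)
    have h32 : (32 : ℝ) = (2 : ℝ) ^ (5 : ℝ) := by norm_num
    have h2 : (2 : ℝ) ^ ((5 : ℝ) * k / 2) ≤ 32 * (2 : ℝ) ^ ((((k - 1 : ℤ) : ℝ)) ^ 2 / 2 + (((k - 1 : ℤ) : ℝ)) / 2) := by
      rw [h32, ← Real.rpow_add two_pos]
      refine Real.rpow_le_rpow_of_exponent_le one_le_two ?_
      push_cast
      nlinarith [sq_nonneg ((k : ℝ) - 3)]
    have h3 : 0 ≤ (32 : ℝ) := by norm_num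
    calc (1 + ε₀) ^ ((5 : ℝ) * k / 2) ≤ 32 * (2 : ℝ) ^ ((((k - 1 : ℤ) : ℝ)) ^ 2 / 2 + (((k - 1 : ℤ) : ℝ)) / 2) :=
          h1.trans h2
      _ ≤ 32 * ω k := mul_le_mul_of_nonneg_left hlow h3

/-- **Backward ratio of the shifted weight**: `ω_k/ω_{k+1} ≤ 1`. [folklore] -/
theorem pgw_shift_ratio_back (hCw : 1 ≤ Cw) (hb : 1 / 2 ≤ b)
    (hwp : ∀ k : ℤ, 0 ≤ k → w k = Cw * (2 : ℝ) ^ ((k : ℝ) ^ 2 / 2 + b * k))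
    (hwn : ∀ k : ℤ, k < 0 → w k = Cw) {ω : ℤ → ℝ} (hω : ∀ k, ω k = w (k - 1)) (k : ℤ) :
    ω k / ω (k + 1) ≤ 1 := by
  rw [hω, hω, div_le_one (lt_of_lt_of_le one_pos (pgw_one_le hCw hb hwp hwn _)),
    show k + 1 - 1 = k - 1 + 1 by ring]
  exact pgw_mono hCw hb hwp hwn (k - 1)

/-- **Pump ratio of the shifted weight**: `(1+ε₀)^{5(k-1)/2} ω_k/ω_{k-1}² ≤ 2^{(9/2-b)²/2 + 2b}`
(`0 ≤ ε₀ ≤ 1`; the exponent `-j²/2 + (9/2-b)j + 2b - 1`, `j = k-1`, is maximal at `j = 9/2 - b`). [folklore] -/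
theorem pgw_shift_ratio_pump {ε₀ : ℝ} (hε : 0 ≤ ε₀) (hε1 : ε₀ ≤ 1) (hCw : 1 ≤ Cw) (hb : 1 / 2 ≤ b)
    (hwp : ∀ k : ℤ, 0 ≤ k → w k = Cw * (2 : ℝ) ^ ((k : ℝ) ^ 2 / 2 + b * k))
    (hwn : ∀ k : ℤ, k < 0 → w k = Cw) {ω : ℤ → ℝ} (hω : ∀ k, ω k = w (k - 1)) (k : ℤ) :
    (1 + ε₀) ^ ((5 : ℝ) * ((k : ℝ) - 1) / 2) * ω k / ω (k - 1) ^ 2 ≤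
      (2 : ℝ) ^ ((9 / 2 - b) ^ 2 / 2 + 2 * b) := by
  have hq1 : (1 : ℝ) ≤ 1 + ε₀ := by linarith
  have hω1 : ∀ j, 1 ≤ ω j := fun j => by rw [hω]; exact pgw_one_le hCw hb hwp hwn _
  have hωpos : ∀ j, 0 < ω j := fun j => lt_of_lt_of_le one_pos (hω1 j)
  have hA3 : (1 : ℝ) ≤ (2 : ℝ) ^ ((9 / 2 - b) ^ 2 / 2 + 2 * b) :=
    Real.one_le_rpow one_le_two (by nlinarith [sq_nonneg (9 / 2 - b)])
  rw [div_le_iff₀ (pow_pos (hωpos _) 2)]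
  by_cases hk : k ≤ 1
  · -- behind: ω_k = ω_{k-1} = C_w and the clock is ≤ 1
    have hwk1 : w (k - 1) = Cw := by
      rcases eq_or_lt_of_le hk with h1 | h1
      · rw [h1]; simp [hwp 0 le_rfl]
      · exact hwn (k - 1) (by omega)
    have hwk2 : w (k - 1 - 1) = Cw := hwn _ (by omega)
    rw [hω k, hω (k - 1), hwk1, hwk2]
    have h1 : (1 + ε₀) ^ ((5 : ℝ) * ((k : ℝ) - 1) / 2) ≤ 1 :=
      Real.rpow_le_one_of_one_le_of_nonpos hq1
        (by have : (k : ℝ) ≤ 1 := (by exact_mod_cast hk); nlinarith)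
    have hCw0 : 0 ≤ Cw := by linarith
    calc (1 + ε₀) ^ ((5 : ℝ) * ((k : ℝ) - 1) / 2) * Cw ≤ 1 * Cw := by nlinarith
      _ ≤ (2 : ℝ) ^ ((9 / 2 - b) ^ 2 / 2 + 2 * b) * Cw ^ 2 := by nlinarith
  · push Not at hk
    -- ahead: explicit Gaussians
    set j : ℤ := k - 1 with hj
    have hj1 : 1 ≤ j := by omega
    have hj0 : (0 : ℝ) ≤ ((j : ℤ) : ℝ) := by exact_mod_cast (by omega : (0 : ℤ) ≤ j)
    have hk1 : k - 1 - 1 = j - 1 := by omega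
    rw [hω k, hω (k - 1), hk1, hwp j (by omega), hwp (j - 1) (by omega)]
    have hkj : ((k : ℝ) - 1) = ((j : ℤ) : ℝ) := by rw [hj]; push_cast; ring
    rw [hkj]
    push_cast
    -- abbreviations for the powers of two
    set E1 : ℝ := ((j : ℤ) : ℝ) ^ 2 / 2 + b * ((j : ℤ) : ℝ) with hE1
    set E2 : ℝ := (((j : ℤ) : ℝ) - 1) ^ 2 / 2 + b * (((j : ℤ) : ℝ) - 1) with hE2
    have h2pos : ∀ e : ℝ, 0 < (2 : ℝ) ^ e := fun e => Real.rpow_pos_of_pos two_pos e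
    -- (1+ε₀)^{5j/2} ≤ 2^{5j/2}
    have hclock : (1 + ε₀) ^ ((5 : ℝ) * ((j : ℤ) : ℝ) / 2) ≤ (2 : ℝ) ^ ((5 : ℝ) * ((j : ℤ) : ℝ) / 2) :=
      Real.rpow_le_rpow (by linarith) (by linarith) (by positivity)
    -- exponent comparison: 5j/2 + E1 ≤ A + 2·E2 with A = (9/2-b)²/2 + 2b
    have hexp : (5 : ℝ) * ((j : ℤ) : ℝ) / 2 + E1 ≤ ((9 / 2 - b) ^ 2 / 2 + 2 * b) + (E2 + E2) := by
      rw [hE1, hE2]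
      nlinarith [sq_nonneg (((j : ℤ) : ℝ) - (9 / 2 - b))]
    have hpow : (2 : ℝ) ^ ((5 : ℝ) * ((j : ℤ) : ℝ) / 2) * (2 : ℝ) ^ E1 ≤
        (2 : ℝ) ^ ((9 / 2 - b) ^ 2 / 2 + 2 * b) * ((2 : ℝ) ^ E2 * (2 : ℝ) ^ E2) := by
      rw [← Real.rpow_add two_pos, ← Real.rpow_add two_pos, ← Real.rpow_add two_pos]
      exact Real.rpow_le_rpow_of_exponent_le one_le_two hexp
    have hCw0 : 0 < Cw := by linarith
    calc (1 + ε₀) ^ ((5 : ℝ) * ((j : ℤ) : ℝ) / 2) * (Cw * (2 : ℝ) ^ E1)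
        ≤ (2 : ℝ) ^ ((5 : ℝ) * ((j : ℤ) : ℝ) / 2) * (Cw * (2 : ℝ) ^ E1) :=
          mul_le_mul_of_nonneg_right hclock (by have := h2pos E1; positivity)
      _ = Cw * ((2 : ℝ) ^ ((5 : ℝ) * ((j : ℤ) : ℝ) / 2) * (2 : ℝ) ^ E1) := by ring
      _ ≤ Cw * ((2 : ℝ) ^ ((9 / 2 - b) ^ 2 / 2 + 2 * b) * ((2 : ℝ) ^ E2 * (2 : ℝ) ^ E2)) :=
          mul_le_mul_of_nonneg_left hpow hCw0.le
      _ ≤ Cw * ((2 : ℝ) ^ ((9 / 2 - b) ^ 2 / 2 + 2 * b) * ((2 : ℝ) ^ E2 * (2 : ℝ) ^ E2)) * Cw := by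
          have h0 : 0 ≤ Cw * ((2 : ℝ) ^ ((9 / 2 - b) ^ 2 / 2 + 2 * b) * ((2 : ℝ) ^ E2 * (2 : ℝ) ^ E2)) := by
            have := h2pos E2; have := h2pos ((9 / 2 - b) ^ 2 / 2 + 2 * b); positivity
          nlinarith
      _ = (2 : ℝ) ^ ((9 / 2 - b) ^ 2 / 2 + 2 * b) * (Cw * (2 : ℝ) ^ E2) ^ 2 := by ring

/-- **The a priori class is inherited**: `(1 + (1+ε₀)^{10k})/ω_k ≤ 2^{57}` (`0 ≤ ε₀ ≤ 1`; the exponent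
comparison `1 + 10k ≤ 57 + (k-1)²/2 + (k-1)/2` is `k² - 21k + 112 ≥ 0`). [folklore] -/
theorem pgw_shift_apriori {ε₀ : ℝ} (hε : 0 ≤ ε₀) (hε1 : ε₀ ≤ 1) (hCw : 1 ≤ Cw) (hb : 1 / 2 ≤ b)
    (hwp : ∀ k : ℤ, 0 ≤ k → w k = Cw * (2 : ℝ) ^ ((k : ℝ) ^ 2 / 2 + b * k))
    (hwn : ∀ k : ℤ, k < 0 → w k = Cw) {ω : ℤ → ℝ} (hω : ∀ k, ω k = w (k - 1)) (k : ℤ) :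
    (1 + (1 + ε₀) ^ ((10 : ℝ) * k)) / ω k ≤ (2 : ℝ) ^ (57 : ℝ) := by
  have hq1 : (1 : ℝ) ≤ 1 + ε₀ := by linarith
  have hωk : 1 ≤ ω k := by rw [hω]; exact pgw_one_le hCw hb hwp hwn _
  have hωpos : 0 < ω k := by linarith
  have h57 : (2 : ℝ) ≤ (2 : ℝ) ^ (57 : ℝ) := by
    have : (2 : ℝ) ^ (57 : ℝ) = (2 : ℝ) ^ (57 : ℕ) := by rw [← Real.rpow_natCast]; norm_num
    rw [this]; norm_num
  rw [div_le_iff₀ hωpos]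
  by_cases hk : k ≤ 0
  · have h1 : (1 + ε₀) ^ ((10 : ℝ) * k) ≤ 1 :=
      Real.rpow_le_one_of_one_le_of_nonpos hq1 (by have : (k : ℝ) ≤ 0 := (by exact_mod_cast hk); linarith)
    nlinarith
  · push Not at hk
    have hk0 : (0 : ℝ) ≤ k := by exact_mod_cast hk.le
    have hlow := pgw_lower hCw hb hwp (k - 1) (by omega)
    rw [← hω] at hlow
    have h1 : (1 + ε₀) ^ ((10 : ℝ) * k) ≤ (2 : ℝ) ^ ((10 : ℝ) * k) :=
      Real.rpow_le_rpow (by linarith) (by linarith) (by positivity)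
    have hone : (1 : ℝ) ≤ (2 : ℝ) ^ ((10 : ℝ) * k) := Real.one_le_rpow one_le_two (by positivity)
    -- 2 · 2^{10k} ≤ 2^57 · 2^{(k-1)²/2 + (k-1)/2}
    have h2 : 2 * (2 : ℝ) ^ ((10 : ℝ) * k) ≤
        (2 : ℝ) ^ (57 : ℝ) * (2 : ℝ) ^ ((((k - 1 : ℤ) : ℝ)) ^ 2 / 2 + (((k - 1 : ℤ) : ℝ)) / 2) := by
      have : 2 * (2 : ℝ) ^ ((10 : ℝ) * k) = (2 : ℝ) ^ (1 + (10 : ℝ) * k) := by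
        rw [Real.rpow_add two_pos, Real.rpow_one]
      rw [this, ← Real.rpow_add two_pos]
      refine Real.rpow_le_rpow_of_exponent_le one_le_two ?_
      push_cast
      nlinarith [sq_nonneg ((k : ℝ) - 21 / 2)]
    have h3 : 0 ≤ (2 : ℝ) ^ (57 : ℝ) := Real.rpow_nonneg zero_le_two _
    calc 1 + (1 + ε₀) ^ ((10 : ℝ) * k) ≤ 2 * (2 : ℝ) ^ ((10 : ℝ) * k) := by linarith
      _ ≤ (2 : ℝ) ^ (57 : ℝ) * (2 : ℝ) ^ ((((k - 1 : ℤ) : ℝ)) ^ 2 / 2 + (((k - 1 : ℤ) : ℝ)) / 2) := h2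
      _ ≤ (2 : ℝ) ^ (57 : ℝ) * ω k := mul_le_mul_of_nonneg_left hlow h3

/-- **Domination of the shifted weight up to the window top**: `ω_k ≤ w_{Ka-1}` for `k ≤ Ka`. [folklore] -/
theorem pgw_shift_low (hCw : 1 ≤ Cw) (hb : 1 / 2 ≤ b)
    (hwp : ∀ k : ℤ, 0 ≤ k → w k = Cw * (2 : ℝ) ^ ((k : ℝ) ^ 2 / 2 + b * k))
    (hwn : ∀ k : ℤ, k < 0 → w k = Cw) {ω : ℤ → ℝ} (hω : ∀ k, ω k = w (k - 1)) {Ka : ℤ} (k : ℤ)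
    (hk : k ≤ Ka) : ω k ≤ w (Ka - 1) := by
  rw [hω]
  -- monotone chain from k-1 up to Ka-1
  obtain ⟨n, hn⟩ : ∃ n : ℕ, Ka - 1 = k - 1 + n := ⟨(Ka - k).toNat, by omega⟩
  rw [hn]
  clear hn hk
  induction n with
  | zero => simp
  | succ n ih =>
      calc w (k - 1) ≤ w (k - 1 + n) := ih
        _ ≤ w (k - 1 + n + 1) := pgw_mono hCw hb hwp hwn _
        _ = w (k - 1 + (n + 1 : ℕ)) := by push_cast; ring_nf

/-- **Domination of the shifted weight beyond the window top**: `ω_k ≤ w_{Ka-1} · w_{k-1}` for all `k`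
(indeed `ω_k = w_{k-1}` and `w_{Ka-1} ≥ 1`). [folklore] -/
theorem pgw_shift_high (hCw : 1 ≤ Cw) (hb : 1 / 2 ≤ b)
    (hwp : ∀ k : ℤ, 0 ≤ k → w k = Cw * (2 : ℝ) ^ ((k : ℝ) ^ 2 / 2 + b * k))
    (hwn : ∀ k : ℤ, k < 0 → w k = Cw) {ω : ℤ → ℝ} (hω : ∀ k, ω k = w (k - 1)) {Ka : ℤ} (k : ℤ) :
    ω k ≤ w (Ka - 1) * w (k - 1) := by
  rw [hω]
  have h1 := pgw_one_le hCw hb hwp hwn (Ka - 1)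
  have h2 : 0 ≤ w (k - 1) := le_trans zero_le_one (pgw_one_le hCw hb hwp hwn (k - 1))
  nlinarith

end PiecewiseGaussian

end CertificateGlueOn

end Summit.NavierStokesRegularity.NavierStokesRegularity.Theorems

end
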